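import Summits.QuantumFields.YangMills.Theorems.BalabanUVNodesN19SingleModeMomentLogFreeBudget

/-!
# YM-DAG node N19 (= NE7 proper) — THE FIRST-ORDER TAIL CORRECTION IN THE UNIFORM MIXED-MOMENT CURRENCY, PART C: THE SINGLE MODE OF THE
# ℓ¹-NORM IS LOG-FREE IN THE MOMENT CURRENCY — `|∫cos(ωΣ_{i≤d}|x_i|)d(P − Q)| ≤ 340·ωd∕L + e^{−L∕2}` for laws with `e^{−L}`-close mixed moments,
# `L ≥ 1024`, `ωd·log₂²L ≤ L∕16384`

Cell `pub-ymgap`, HUMAN RULING D-0062 (Track A) ∕ D-0149 (work-bound push), R141 (C) wider-strategy seat `pub-ymgap-dag-n19-e` (strategy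
s3 = ALTERNATIVE CURRENCY), generation g32, module 8 (lineage module 146).  Route `Summits/QuantumFields/YangMills/Theses/BalabanUVNodes.lean`,
cluster item K3⁸ «SpineGivenEndpointR13SepCoPHV» (stmt-QuantumFields-27366); filed `--supports` that item `--as helper` (it proves no registered
stub).  COUNT-NEUTRAL: [folklore]∕[bookkeeping] over Mathlib and the lineage BY NAME — PART B `…N19SingleModeMomentFirstOrderLadder`
(`exists_pair_near_cexp_l1Norm_firstOrder_mass`), PART A (`exists_pair_firstOrder_step_mass`), module 128 (`exists_additiveJackson_mass`), module 127
(`abs_integral_eval_sub_le_mass`, `mass_sub_le`, `mass_C_le`), module 119 (`abs_l1Norm_sub_half_le`), modules 65∕62 (`abs_integral_le_of_cube`,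
`integrable_of_continuous_of_cube`); TOY laws under HYPOTHESES, no scheme object, no Theses import; NOT a discharge claim.

CONTENT (PART C1 `…N19SingleModeMomentLogFreeBudget` has the price `abs_integral_sub_le_of_near_mass`, the scale `exists_scale_L`, the order
`exists_order_L` and the log-mass budget `logmass_le ≤ L∕2`).  §1 ★★★ `exists_pair_near_cexp_l1Norm_logFree_mass` (a pair within `170·ωd∕L` of
`e^{iωΣ|x_i|}` with `mass·e^{−L} ≤ e^{−L∕2}`) · §2 ★★★ `abs_integral_cos_l1Norm_sub_le_logFree` ∕ `…sin…`: for probability laws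
`P, Q` on `ℝ^ι` carried by `[−1,1]^ι` with `|∫∏x_i^{j_i}dP − ∫∏x_i^{j_i}dQ| ≤ e^{−L}` for every `j`, `L ≥ 1024`, `ω ≥ 0`, `ωd·(log₂L)² ≤ L∕16384`:
**`|∫cos(ωΣ_i|x_i|)dP − ∫cos(ωΣ_i|x_i|)dQ| ≤ 340·ωd∕L + e^{−L∕2}`** (`N = ⌊L∕16⌋`, `τ ≤ 32πa∕L`; empty ladder if `π²aL ≤ 64`).
READING (CURRENCY-MAP v10, honest): the row «UNIFORM MOMENTS `r` → single mode of `d` strings» read `ωd·log2∕(20πL) ≤ · ≤ C·ωd·log²L∕L`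
(modules 138 ∕ 129, `L = log r⁻¹`); it is now **`Θ(ωd∕L)` up to an absolute constant** (and the additive `e^{−L∕2}`) in the regime `ωd ≲ L∕log²L` — the
moment-currency twin of modules 139–141: the `log²L` was the Jackson ladder's, not the problem's.  Constants (`340`, `16384`, `1024`) nowhere optimised.

HONEST FRAMING (binding).  Elementary and [folklore]; TOY laws under hypotheses; NO consumer in the DAG today (the seat's own currency map); nothing
of Bałaban's instantiated; NE7 NOT PRINTED, NOT proved; N19 NOT discharged; count-neutral.  One finite `T⁴` programme at fixed `ε`; nothing continuum ∕
`ℝ⁴` ∕ OS ∕ mass-gap ∕ Clay.  0 `def` ∕ 0 `sorry`.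
-/

noncomputable section

open Finset Complex MeasureTheory
open scoped Real

namespace Summit.QuantumFields.YangMills.Theorems.BalabanUVNodesN19SingleModeMomentLogFree

open Summit.QuantumFields.YangMills.Theorems.BalabanUVNodesN19SingleModeMomentFirstOrderLadder
  (exists_pair_near_cexp_l1Norm_firstOrder_mass)
open Summit.QuantumFields.YangMills.Theorems.BalabanUVNodesN19SingleModeMomentFirstOrder (exists_pair_firstOrder_step_mass)
open Summit.QuantumFields.YangMills.Theorems.BalabanUVNodesN19SingleModeMomentLadder (exists_additiveJackson_mass)
open Summit.QuantumFields.YangMills.Theorems.BalabanUVNodesN19CoefficientMassPricing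
open Summit.QuantumFields.YangMills.Theorems.BalabanUVNodesN19SingleModeL1Norm (abs_l1Norm_sub_half_le)
open Summit.QuantumFields.YangMills.Theorems.BalabanUVNodesN19SingleModeMomentLogFreeBudget

variable {ι : Type*} [Fintype ι]

/-! ## §1 ★★★ The log-free pair with mass [folklore] -/

/-- ★★★ **THE LOG-FREE PAIR WITH MASS.**  For `L ≥ 1024`, `ω ≥ 0` and finite `ι` (`d = |ι|`) with `ωd·(log₂L)² ≤ L∕16384` there is a pair of real
`MvPolynomial`s `(Cr, Ci)` with `mass(Cr)·e^{−L}, mass(Ci)·e^{−L} ≤ e^{−L∕2}` and `‖Cr(x) + Ci(x)·i − e^{iωΣ_i|x_i|}‖ ≤ 170·ωd∕L` on `[−1,1]^ι`.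
With `a = ωd`, `N = ⌊L∕16⌋` (`aπ∕N ≤ 32πa∕L`): if `π²aL ≤ 64` the EMPTY ladder (`e^{iωd∕2}·(1 + iω(A_N − d∕2))`, PART A §4: sup `(a∕2)² + aπ∕N`,
mass `≤ 1 + a(N9^N + ½)`, log-mass `≤ a + N + N log 9 ≤ L∕2`); else PART C1's scale `J` and order `h` in PART B's parametric form (sup
`≤ 3a∕L + 64a∕L + 32πa∕L ≤ 170a∕L`, log-mass `≤ L∕2` by `logmass_le`). [folklore] -/
theorem exists_pair_near_cexp_l1Norm_logFree_mass {L : ℝ} (hL : 1024 ≤ L) {ω : ℝ} (hω : 0 ≤ ω)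
    (hreg : ω * Fintype.card ι * Real.logb 2 L ^ 2 ≤ L / 16384) :
    ∃ Cr Ci : MvPolynomial ι ℝ,
      (∑ s ∈ Cr.support, |Cr.coeff s|) * Real.exp (-L) ≤ Real.exp (-L / 2) ∧
      (∑ s ∈ Ci.support, |Ci.coeff s|) * Real.exp (-L) ≤ Real.exp (-L / 2) ∧
      ∀ x : ι → ℝ, (∀ i, x i ∈ Set.Icc (-1 : ℝ) 1) →
        ‖((MvPolynomial.eval x Cr : ℝ) : ℂ) + ((MvPolynomial.eval x Ci : ℝ) : ℂ) * I - exp (((ω * ∑ i, |x i| : ℝ) : ℂ) * I)‖ ≤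
          170 * (ω * Fintype.card ι) / L := by
  set d : ℝ := (Fintype.card ι : ℝ) with hd
  set a : ℝ := ω * d with ha
  have hd0 : 0 ≤ d := Nat.cast_nonneg _
  have ha0 : 0 ≤ a := mul_nonneg hω hd0
  have hL0 : 0 < L := by linarith
  have hr0 : 0 ≤ Real.exp (-L) := (Real.exp_pos _).le
  have hπhi : π < 3.15 := Real.pi_lt_d2
  have hπlo : 3.14 < π := Real.pi_gt_d2
  have hLb10 : 10 ≤ Real.logb 2 L := by
    rw [Real.le_logb_iff_rpow_le one_lt_two hL0]
    have e : (2 : ℝ) ^ (10 : ℝ) = 1024 := by norm_num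
    rw [e]; exact hL
  have haL16 : a ≤ L / 1638400 := by
    have h1 : a * 100 ≤ a * Real.logb 2 L ^ 2 := mul_le_mul_of_nonneg_left (by nlinarith only [hLb10]) ha0
    linarith only [h1, hreg]
  -- the correction scale `N = ⌊L/16⌋`
  set N : ℕ := ⌊L / 16⌋₊ with hN
  have hNle : (N : ℝ) ≤ L / 16 := Nat.floor_le (by positivity)
  have hNge : L / 16 - 1 ≤ N := by have := Nat.lt_floor_add_one (L / 16); linarith
  have hN1 : (1 : ℝ) ≤ N := by linarith
  have hNpos : 0 < N := by exact_mod_cast (show (0 : ℝ) < N by linarith)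
  have hNr : (0 : ℝ) < N := by exact_mod_cast hNpos
  have hτ : a * π / N ≤ 32 * π * a / L := by
    rw [div_le_div_iff₀ hNr hL0]; nlinarith only [hNge, hL, mul_nonneg ha0 Real.pi_pos.le]
  have hτ1 : a * π / N ≤ 1 := hτ.trans (by
    rw [div_le_one hL0]
    have h1 : 32 * π * a ≤ 32 * 3.15 * a := by nlinarith only [hπhi, ha0]
    linarith only [h1, haL16, hL0])
  have hlog9 : Real.log 9 ≤ 2.773 := by
    have h3 : Real.log 9 ≤ Real.log (2 ^ 4) := Real.log_le_log (by norm_num) (by norm_num)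
    rw [Real.log_pow] at h3; push_cast at h3; linarith only [h3, Real.log_two_lt_d9]
  -- `mass·e^{−L} ≤ e^{−L/2}` when `log mass ≤ L/2` (and trivially when `mass ≤ 0`)
  have hprice : ∀ {m 𝓜 : ℝ}, m ≤ 𝓜 → 0 < 𝓜 → Real.log 𝓜 ≤ L / 2 → m * Real.exp (-L) ≤ Real.exp (-L / 2) := by
    intro m 𝓜 hm h0 hlog
    have h1 : 𝓜 ≤ Real.exp (L / 2) := by rw [← Real.exp_log h0]; exact Real.exp_le_exp.2 hlog
    calc m * Real.exp (-L) ≤ Real.exp (L / 2) * Real.exp (-L) := mul_le_mul_of_nonneg_right (hm.trans h1) hr0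
      _ = Real.exp (-L / 2) := by rw [← Real.exp_add]; ring_nf
  by_cases hA : π ^ 2 * a * L ≤ 64
  · -- the empty ladder with mass
    have ha2 : a ≤ 2 := by
      have hπ2lo : 9 ≤ π ^ 2 := by nlinarith only [hπlo]
      have h1 : 9 * (a * 1024) ≤ π ^ 2 * (a * L) :=
        mul_le_mul hπ2lo (mul_le_mul_of_nonneg_left hL ha0) (by positivity) (by positivity)
      have h2 : π ^ 2 * (a * L) = π ^ 2 * a * L := by ring
      linarith only [h1, h2, hA]
    obtain ⟨AN, hANmass, hANerr⟩ := exists_additiveJackson_mass (ι := ι) (M := N) hNpos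
    have hCr₀ : (∑ s ∈ (MvPolynomial.C (Real.cos (ω * (d / 2))) : MvPolynomial ι ℝ).support,
        |(MvPolynomial.C (Real.cos (ω * (d / 2))) : MvPolynomial ι ℝ).coeff s|) ≤ 1 := (mass_C_le _).trans (Real.abs_cos_le_one _)
    have hCi₀ : (∑ s ∈ (MvPolynomial.C (Real.sin (ω * (d / 2))) : MvPolynomial ι ℝ).support,
        |(MvPolynomial.C (Real.sin (ω * (d / 2))) : MvPolynomial ι ℝ).coeff s|) ≤ 1 := (mass_C_le _).trans (Real.abs_sin_le_one _)
    have hΔm : (∑ s ∈ (AN - MvPolynomial.C (d / 2)).support, |(AN - MvPolynomial.C (d / 2)).coeff s|) ≤ d * (N * 9 ^ N) + d / 2 := by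
      refine (mass_sub_le _ _).trans (add_le_add (by rw [hd]; exact hANmass) ?_)
      exact (mass_C_le _).trans (by rw [abs_of_nonneg (by positivity)])
    have happ₀ : ∀ x : ι → ℝ, (∀ i, x i ∈ Set.Icc (-1 : ℝ) 1) →
        ‖((MvPolynomial.eval x (MvPolynomial.C (Real.cos (ω * (d / 2)))) : ℝ) : ℂ) +
            ((MvPolynomial.eval x (MvPolynomial.C (Real.sin (ω * (d / 2)))) : ℝ) : ℂ) * I -
            exp ((((fun _ : ι → ℝ => ω * (d / 2)) x : ℝ) : ℂ) * I)‖ ≤ 0 := by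
      intro x _
      rw [MvPolynomial.eval_C, MvPolynomial.eval_C]
      have h0 : ((Real.cos (ω * (d / 2)) : ℝ) : ℂ) + ((Real.sin (ω * (d / 2)) : ℝ) : ℂ) * I = exp (((ω * (d / 2) : ℝ) : ℂ) * I) := by
        rw [Complex.exp_mul_I, Complex.ofReal_cos, Complex.ofReal_sin]
      rw [h0, sub_self, norm_zero]
    have hE : ∀ x : ι → ℝ, (∀ i, x i ∈ Set.Icc (-1 : ℝ) 1) → |ω * ((∑ i, |x i|) - d / 2)| ≤ ω * d / 2 := by
      intro x hx
      rw [abs_mul, abs_of_nonneg hω, mul_div_assoc]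
      exact mul_le_mul_of_nonneg_left (abs_l1Norm_sub_half_le x hx) hω
    have hEΔ : ∀ x : ι → ℝ, (∀ i, x i ∈ Set.Icc (-1 : ℝ) 1) →
        |ω * (((∑ i, |x i|) - d / 2) - MvPolynomial.eval x (AN - MvPolynomial.C (d / 2)))| ≤ a * π / N := by
      intro x hx
      have e : ((∑ i, |x i|) - d / 2) - MvPolynomial.eval x (AN - MvPolynomial.C (d / 2)) = (∑ i, |x i|) - MvPolynomial.eval x AN := by
        rw [map_sub, MvPolynomial.eval_C]; ring
      rw [e, abs_mul, abs_of_nonneg hω]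
      calc ω * |(∑ i, |x i|) - MvPolynomial.eval x AN| ≤ ω * (Fintype.card ι * (π / N)) := mul_le_mul_of_nonneg_left (hANerr x hx) hω
        _ = a * π / N := by rw [ha, hd]; ring
    have hρ1 : ω * d / 2 ≤ 1 := by rw [← ha]; linarith
    obtain ⟨Cr, Ci, hCr, hCi, happ⟩ := exists_pair_firstOrder_step_mass (θ := fun _ : ι → ℝ => ω * (d / 2))
      (E := fun x => (∑ i, |x i|) - d / 2) hCr₀ hCi₀ hΔm le_rfl hρ1 hω happ₀ hE hEΔ
    -- the log-mass of the empty ladder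
    have hmass1 : (1 : ℝ) * (1 + ω * (d * (N * 9 ^ N) + d / 2)) ≤ (1 + a) * ((N + 1) * 9 ^ N) := by
      have h9 : (1 : ℝ) ≤ 9 ^ N := one_le_pow₀ (by norm_num)
      have e : ω * (d * (N * 9 ^ N) + d / 2) = a * (N * 9 ^ N) + a / 2 := by rw [ha]; ring
      rw [one_mul, e]
      nlinarith only [ha0, hNr, h9, mul_nonneg (mul_nonneg ha0 hNr.le) (by linarith only [h9] : (0 : ℝ) ≤ 9 ^ N)]
    have hlogm : Real.log ((1 + a) * ((N + 1) * 9 ^ N)) ≤ L / 2 := by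
      rw [Real.log_mul (by positivity) (by positivity), Real.log_mul (by positivity) (by positivity), Real.log_pow]
      have h1 : Real.log (1 + a) ≤ a := by have := Real.log_le_sub_one_of_pos (show 0 < 1 + a by linarith); linarith
      have h2 : Real.log ((N : ℝ) + 1) ≤ N := by have := Real.log_le_sub_one_of_pos (show (0 : ℝ) < N + 1 by linarith); linarith
      have h4 : (N : ℝ) * Real.log 9 ≤ (L / 16) * 2.773 := mul_le_mul hNle hlog9 (Real.log_nonneg (by norm_num)) (by positivity)
      linarith only [h1, h2, h4, hNle, ha2, hL]
    refine ⟨Cr, Ci, hprice (hCr.trans hmass1) (by positivity) hlogm, hprice (hCi.trans hmass1) (by positivity) hlogm, fun x hx => ?_⟩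
    have h1 := happ x hx
    have harg : ω * (d / 2) + ω * ((∑ i, |x i|) - d / 2) = ω * ∑ i, |x i| := by ring
    simp only [harg, zero_mul, zero_add] at h1
    refine h1.trans ?_
    -- `(a/2)² + aπ/N ≤ 170 a/L`
    have h2 : (ω * d / 2) ^ 2 ≤ 2 * a / L := by
      rw [← ha, div_pow, div_le_div_iff₀ (by norm_num) hL0]
      have h3 := mul_le_mul_of_nonneg_left hA ha0
      have hπ2lo : 9 ≤ π ^ 2 := by nlinarith only [hπlo]
      nlinarith only [h3, mul_nonneg (sub_nonneg.2 hπ2lo) (by positivity : (0 : ℝ) ≤ a ^ 2 * L), ha0]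
    have h3 : 2 * a / L + 32 * π * a / L ≤ 170 * a / L := by
      rw [← add_div]; exact div_le_div_of_nonneg_right (by nlinarith only [hπhi, ha0]) hL0.le
    linarith only [h2, hτ, h3]
  · -- the ladder with the first-order correction, with mass
    have hbig : 64 < π ^ 2 * a * L := lt_of_not_ge hA
    obtain ⟨J, hP5, hP4, hMlt, hP3, hJ1L⟩ := exists_scale_L hL ha0 hreg hbig
    obtain ⟨h, hh1, hhle, hexph⟩ := exists_order_L hL
    have h2J : (0 : ℝ) < 2 ^ J := by positivity
    have hJ12J : (J : ℝ) + 1 ≤ 2 ^ J := by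
      have h1 : J + 1 ≤ 2 ^ J := Nat.lt_two_pow_self
      exact_mod_cast h1
    have hε : ((J : ℝ) + 1) * Real.exp (-(h : ℝ)) ≤ 1 / (4 * L ^ 2) := by
      calc ((J : ℝ) + 1) * Real.exp (-(h : ℝ)) ≤ (L / 4) * (1 / L ^ 3) :=
            mul_le_mul (hJ12J.trans hP3) hexph (Real.exp_pos _).le (by positivity)
        _ = 1 / (4 * L ^ 2) := by field_simp
    have hJh : ((J : ℝ) + 1) * Real.exp (-(h : ℝ)) ≤ 1 / 2 := by
      refine hε.trans ?_
      rw [div_le_div_iff₀ (by positivity) (by norm_num : (0 : ℝ) < 2)]; nlinarith only [hL]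
    have hε₁ : 2 * ((J : ℝ) + 1) * Real.exp (-(h : ℝ)) ≤ a / L := by
      have hat : 6 < a * L := by
        have hππ : π * π < 3.15 * 3.15 := mul_lt_mul'' hπhi hπhi Real.pi_pos.le Real.pi_pos.le
        have h0 : π ^ 2 * a * L ≤ 9.93 * (a * L) := by
          rw [mul_assoc]; exact mul_le_mul_of_nonneg_right (by rw [pow_two]; linarith only [hππ]) (mul_nonneg ha0 hL0.le)
        linarith only [h0, hbig]
      have h1 : 2 * ((J : ℝ) + 1) * Real.exp (-(h : ℝ)) ≤ 2 * (1 / (4 * L ^ 2)) := by linarith only [hε]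
      refine h1.trans ?_
      have e1 : 2 * (1 / (4 * L ^ 2)) = 1 / (2 * L ^ 2) := by field_simp; norm_num
      rw [e1, div_le_div_iff₀ (by positivity) hL0, one_mul, show a * (2 * L ^ 2) = L * (2 * (a * L)) by ring]
      exact le_mul_of_one_le_right hL0.le (by linarith only [hat])
    have hNJ : 2 ^ J ≤ N := by
      have hM10 : (2 : ℝ) ^ J * 5120 ≤ 2 ^ J * (512 * Real.logb 2 L) := by nlinarith only [hLb10, h2J]
      have hMle : (2 : ℝ) ^ J ≤ L / 1625 := by nlinarith only [hM10, hMlt, hπhi, hL0]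
      have h1 : ((2 ^ J : ℕ) : ℝ) ≤ (N : ℝ) := by push_cast; linarith only [hMle, hNge, hL]
      exact_mod_cast h1
    obtain ⟨Cr, Ci, hCr, hCi, happ⟩ := exists_pair_near_cexp_l1Norm_firstOrder_mass (ι := ι) hω J h N hh1 hJh hNJ hP4
    -- the log-mass budget
    have hMr : (2 : ℝ) ^ J * (512 * Real.logb 2 L) ≤ π * L := hMlt.le
    have h9 : ((9 : ℝ) ^ N : ℝ) = (9 : ℝ) ^ ((N : ℕ) : ℝ) := (Real.rpow_natCast 9 N).symm
    have hbudget := logmass_le (M := (2 : ℝ) ^ J) (N := (N : ℝ)) (Jr := (J : ℝ)) hL ha0 hreg hJ12J (Nat.cast_nonneg J) hJ1L hMr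
      hhle hN1 hNle
    rw [← h9] at hbudget
    have e2 : (2 : ℝ) * 2 ^ J - 1 = 2 ^ (J + 1) - 1 := by rw [pow_succ]; ring
    rw [e2] at hbudget
    have hlogm : Real.log (Real.exp (((J : ℝ) + 1) * Real.log 2 +
          (6 * π * Real.exp 2 * (ω * Fintype.card ι) + h * ((J : ℝ) + 1)) * Real.log (1 + 10 * (ω * Fintype.card ι)) +
          (3 * π * Real.exp 2 * (ω * Fintype.card ι) * ((J : ℝ) + 1) + h * (2 ^ (J + 1) - 1)) * Real.log 81) *
        (1 + 2 * (ω * Fintype.card ι) * (N * 9 ^ N))) ≤ L / 2 := by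
      rw [Real.log_mul (by positivity) (by positivity), Real.log_exp]
      exact hbudget
    refine ⟨Cr, Ci, hprice hCr (by positivity) hlogm, hprice hCi (by positivity) hlogm, fun x hx => (happ x hx).trans ?_⟩
    -- the sup-error: `ε₁(1 + ρ + τ) + ρ² + τ ≤ 3a/L + 64a/L + 32πa/L ≤ 170a/L`
    have hρ1 : a * π / 2 ^ J ≤ 1 := by rw [div_le_one h2J]; exact hP4
    have s1 : 2 * ((J : ℝ) + 1) * Real.exp (-(h : ℝ)) * (1 + a * π / 2 ^ J + a * π / N) ≤ a / L * 3 :=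
      mul_le_mul hε₁ (by linarith only [hρ1, hτ1]) (by positivity) (by positivity)
    have h2 : a / L * 3 + 64 * a / L + 32 * π * a / L ≤ 170 * a / L := by
      have e : a / L * 3 + 64 * a / L + 32 * π * a / L = (67 + 32 * π) * a / L := by ring
      rw [e]; exact div_le_div_of_nonneg_right (by nlinarith only [hπhi, ha0]) hL0.le
    linarith only [s1, hP5, hτ, h2]

/-! ## §2 ★★★ The single mode in the moment currency, log-free [folklore] -/

/-- ★★★ **THE SINGLE MODE `cos(ωΣ_{i≤d}|x_i|)` OF `d` STRINGS IS LOG-FREE IN THE UNIFORM MIXED-MOMENT CURRENCY.**  Let `P, Q` be probability laws on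
`ℝ^ι` carried by `[−1,1]^ι` with `|∫∏x_i^{j_i}dP − ∫∏x_i^{j_i}dQ| ≤ e^{−L}` for every `j`, `L ≥ 1024`, `ω ≥ 0`, `ωd·(log₂L)² ≤ L∕16384`.  Then
`|∫cos(ωΣ_i|x_i|)dP − ∫cos(ωΣ_i|x_i|)dQ| ≤ 340·ωd∕L + e^{−L∕2}` (§1 priced by PART C1's `abs_integral_sub_le_of_near_mass`).
READING: against module 138's lower bound `ωd·log 2∕(20πL)` (laws with `2^{−t}`-close moments, `L = t log 2`) the row «UNIFORM MOMENTS → single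
mode» is `Θ(ωd∕L)` up to an absolute constant and the additive `e^{−L∕2}`, for `ωd ≲ L∕log²L` — no `log²L`. [folklore] -/
theorem abs_integral_cos_l1Norm_sub_le_logFree {P Q : Measure (ι → ℝ)} [IsProbabilityMeasure P] [IsProbabilityMeasure Q]
    (hP : P (Set.pi Set.univ (fun _ : ι => Set.Icc (-1 : ℝ) 1))ᶜ = 0) (hQ : Q (Set.pi Set.univ (fun _ : ι => Set.Icc (-1 : ℝ) 1))ᶜ = 0)
    {L : ℝ} (hL : 1024 ≤ L) (hmom : ∀ j : ι → ℕ, |∫ x, ∏ i, x i ^ j i ∂P - ∫ x, ∏ i, x i ^ j i ∂Q| ≤ Real.exp (-L))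
    {ω : ℝ} (hω : 0 ≤ ω) (hreg : ω * Fintype.card ι * Real.logb 2 L ^ 2 ≤ L / 16384) :
    |∫ x, Real.cos (ω * ∑ i, |x i|) ∂P - ∫ x, Real.cos (ω * ∑ i, |x i|) ∂Q| ≤ 340 * (ω * Fintype.card ι) / L + Real.exp (-L / 2) := by
  obtain ⟨Cr, Ci, hCr, -, happ⟩ := exists_pair_near_cexp_l1Norm_logFree_mass (ι := ι) hL hω hreg
  have hg : Continuous fun x : ι → ℝ => Real.cos (ω * ∑ i, |x i|) :=
    Real.continuous_cos.comp (continuous_const.mul (continuous_finsetSum _ fun i _ => (continuous_apply i).abs))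
  have happ' : ∀ x : ι → ℝ, (∀ i, x i ∈ Set.Icc (-1 : ℝ) 1) → |Real.cos (ω * ∑ i, |x i|) - MvPolynomial.eval x Cr| ≤
      170 * (ω * Fintype.card ι) / L := by
    intro x hx
    have hre : (((MvPolynomial.eval x Cr : ℝ) : ℂ) + ((MvPolynomial.eval x Ci : ℝ) : ℂ) * I -
        exp (((ω * ∑ i, |x i| : ℝ) : ℂ) * I)).re = MvPolynomial.eval x Cr - Real.cos (ω * ∑ i, |x i|) := by
      simp only [Complex.sub_re, Complex.add_re, Complex.mul_re, Complex.ofReal_re, Complex.ofReal_im, Complex.I_re,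
        Complex.I_im, Complex.exp_ofReal_mul_I_re]
      ring
    rw [abs_sub_comm, ← hre]
    exact (Complex.abs_re_le_norm _).trans (happ x hx)
  have h := abs_integral_sub_le_of_near_mass hP hQ (Real.exp_pos _).le hmom hg happ' le_rfl
  refine h.trans ?_
  have e : 2 * (170 * (ω * Fintype.card ι) / L) = 340 * (ω * Fintype.card ι) / L := by ring
  rw [e]; exact add_le_add le_rfl hCr

/-- ★★★ **THE SINGLE MODE `sin(ωΣ_{i≤d}|x_i|)` IN THE UNIFORM MIXED-MOMENT CURRENCY, LOG-FREE** (the imaginary part; same hypotheses):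
`|∫sin(ωΣ_i|x_i|)dP − ∫sin(ωΣ_i|x_i|)dQ| ≤ 340·ωd∕L + e^{−L∕2}` — against module 138's explicit pair paying `≥ ωd·log2∕(20πL)`. [folklore] -/
theorem abs_integral_sin_l1Norm_sub_le_logFree {P Q : Measure (ι → ℝ)} [IsProbabilityMeasure P] [IsProbabilityMeasure Q]
    (hP : P (Set.pi Set.univ (fun _ : ι => Set.Icc (-1 : ℝ) 1))ᶜ = 0) (hQ : Q (Set.pi Set.univ (fun _ : ι => Set.Icc (-1 : ℝ) 1))ᶜ = 0)
    {L : ℝ} (hL : 1024 ≤ L) (hmom : ∀ j : ι → ℕ, |∫ x, ∏ i, x i ^ j i ∂P - ∫ x, ∏ i, x i ^ j i ∂Q| ≤ Real.exp (-L))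
    {ω : ℝ} (hω : 0 ≤ ω) (hreg : ω * Fintype.card ι * Real.logb 2 L ^ 2 ≤ L / 16384) :
    |∫ x, Real.sin (ω * ∑ i, |x i|) ∂P - ∫ x, Real.sin (ω * ∑ i, |x i|) ∂Q| ≤ 340 * (ω * Fintype.card ι) / L + Real.exp (-L / 2) := by
  obtain ⟨Cr, Ci, -, hCi, happ⟩ := exists_pair_near_cexp_l1Norm_logFree_mass (ι := ι) hL hω hreg
  have hg : Continuous fun x : ι → ℝ => Real.sin (ω * ∑ i, |x i|) :=
    Real.continuous_sin.comp (continuous_const.mul (continuous_finsetSum _ fun i _ => (continuous_apply i).abs))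
  have happ' : ∀ x : ι → ℝ, (∀ i, x i ∈ Set.Icc (-1 : ℝ) 1) → |Real.sin (ω * ∑ i, |x i|) - MvPolynomial.eval x Ci| ≤
      170 * (ω * Fintype.card ι) / L := by
    intro x hx
    have him : (((MvPolynomial.eval x Cr : ℝ) : ℂ) + ((MvPolynomial.eval x Ci : ℝ) : ℂ) * I -
        exp (((ω * ∑ i, |x i| : ℝ) : ℂ) * I)).im = MvPolynomial.eval x Ci - Real.sin (ω * ∑ i, |x i|) := by
      simp only [Complex.sub_im, Complex.add_im, Complex.mul_im, Complex.ofReal_re, Complex.ofReal_im, Complex.I_re,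
        Complex.I_im, Complex.exp_ofReal_mul_I_im]
      ring
    rw [abs_sub_comm, ← him]
    exact (Complex.abs_im_le_norm _).trans (happ x hx)
  have h := abs_integral_sub_le_of_near_mass hP hQ (Real.exp_pos _).le hmom hg happ' le_rfl
  refine h.trans ?_
  have e : 2 * (170 * (ω * Fintype.card ι) / L) = 340 * (ω * Fintype.card ι) / L := by ring
  rw [e]; exact add_le_add le_rfl hCi

end Summit.QuantumFields.YangMills.Theorems.BalabanUVNodesN19SingleModeMomentLogFree

end
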